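import Summits.Schanuel.Schanuel.Theorems.ZilberEacGraphCurveEscapePolyLemmas
import HarnessLib

/-!
# Graph base × curve, VI: the escape engine with POLYNOMIAL coefficients (non-split surfaces)

HONEST FRAMING.  Cell `pub-schanuel` (Zilber's Exponential-Algebraic Closedness, case ladder;
host summit Schanuel), seat 2, gen 16.  Engine for NON-SPLIT surfaces
`{x₁ = p(x₀), P(x₀; y₀, y₁) = 0}` over a graph base: along the graph the defining equation is an
exponential sum `Σ_v c_v(z) e^{v₀ z + v₁ p(z)}` with POLYNOMIAL coefficients `c_v ∈ ℂ[z]`, and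
after the Newton-polygon edge decomposition one must find zeros of
`g(z) = Σ_j q_j(z) e^{j R(z)} + E(z)` with `q_j ∈ ℂ[z]` and `‖E(z)‖ ≤ C_B (1 + ‖z‖)^N e^{δ Re z}`.
NOT Schanuel's conjecture (neither used nor implied; EAC ⇏ SC); `EC(3,2)` stays OPEN; the density
theorems built on this engine are instances of Mantova–Masser's OPEN question (PLMS 2024, §1 p. 5).

`exists_escape_zeros_poly`: `R ∈ ℂ[z]` of degree `d ≥ 2`; finitely many exponents `j ∈ J` with
coefficients `q_j` of degree `≤ n`; the TOP polynomial `Q_top(u) = Σ_j [zⁿ]q_j · u^j` has a root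
`θ ≠ 0` and is not zero; `E` entire with the polynomially weighted decay bound.  Then `g` has zeros
`z_k` with `Re z_k ≤ -L_k`, `‖z_k‖ ≤ 16 L_k + 17`, `L_k → ∞`.  Proof: as `exists_escape_zeros`
(root direction, exact roots `z₀(k)` of `R(z₀) = 2πiN + log θ`, local coordinate
`φ(u) = z₀e^{u/(dT')}`), with the rescaled functions `G_k(u) = g(φ u)/z₀ⁿ`; the new estimate is
`‖q_j(φ u)/z₀ⁿ - [zⁿ]q_j‖ ≤ K_j/‖z₀‖` on `‖u‖ ≤ 1` (`norm_eval_div_pow_sub_coeff_le`), so that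
`G_k → Q_top(θ e^u)` uniformly; Hurwitz persistence.
-/

noncomputable section

open Filter Topology Metric Set Complex Polynomial
open Literature.ModelTheory.Zilber

set_option linter.dupNamespace false

namespace Summit.Schanuel.Schanuel.Theorems

/-! ## Part B. The engine with polynomial coefficients -/

/-- **Escaping zeros of `Σ_j q_j(z) e^{e_j R(z)} + E(z)` (polynomial coefficients).**  `R` of
degree `≥ 2`; `q_j ∈ ℂ[z]` (`j ∈ J`, exponents `e_j ∈ ℕ`) of degree `≤ n`; the top polynomial
`Σ_j [zⁿ]q_j X^{e_j}` is nonzero with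
a root `θ ≠ 0`; `E` entire with `‖E(z)‖ ≤ C_B (1 + ‖z‖)^N e^{δ Re z}` for `Re z ≤ 0`, `|Re R(z)| ≤ B`.
Then there are zeros `z_k` with `Re z_k ≤ -L_k`, `‖z_k‖ ≤ 16 L_k + 17`, `L_k → ∞`. (new) -/
theorem exists_escape_zeros_poly {ι : Type*} (R : Polynomial ℂ) (hd : 2 ≤ R.natDegree)
    (J : Finset ι) (q : ι → Polynomial ℂ) (e : ι → ℕ) (n : ℕ)
    (hq : ∀ j ∈ J, (q j).natDegree ≤ n) {θ : ℂ} (hθ0 : θ ≠ 0)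
    (hθ : (∑ j ∈ J, Polynomial.C ((q j).coeff n) * Polynomial.X ^ (e j)).eval θ = 0)
    (hQ : (∑ j ∈ J, Polynomial.C ((q j).coeff n) * Polynomial.X ^ (e j)) ≠ 0)
    (E : ℂ → ℂ) (hE : Differentiable ℂ E) {δ : ℝ} (hδ : 0 < δ)
    (hEb : ∀ B : ℝ, ∃ C : ℝ, 0 ≤ C ∧ ∃ N : ℕ,
      ∀ z : ℂ, z.re ≤ 0 → |(R.eval z).re| ≤ B → ‖E z‖ ≤ C * (1 + ‖z‖) ^ N * Real.exp (δ * z.re)) :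
    ∃ (z : ℕ → ℂ) (L : ℕ → ℝ), Tendsto L atTop atTop ∧
      ∀ k, (∑ j ∈ J, (q j).eval (z k) * exp (R.eval (z k)) ^ (e j)) + E (z k) = 0 ∧
        (z k).re ≤ -L k ∧ ‖z k‖ ≤ 16 * L k + 17 := by
  classical
  -- notation
  set Qt : Polynomial ℂ := ∑ j ∈ J, Polynomial.C ((q j).coeff n) * Polynomial.X ^ (e j) with hQt
  set d : ℕ := R.natDegree with hd_def
  set a : ℂ := R.leadingCoeff with ha_def
  set ℓ : Polynomial ℂ := R.eraseLead with hℓ_def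
  have hd0 : d ≠ 0 := by omega
  have hR0 : R ≠ 0 := by
    rintro rfl
    rw [hd_def, Polynomial.natDegree_zero] at hd
    omega
  have ha0 : a ≠ 0 := Polynomial.leadingCoeff_ne_zero.2 hR0
  have hapos : 0 < ‖a‖ := norm_pos_iff.2 ha0
  set c₀ : ℂ := Complex.log θ with hc₀_def
  have hc₀ : exp c₀ = θ := Complex.exp_log hθ0
  -- a root direction
  obtain ⟨ω, s, hs, hω, hre⟩ := exists_rootDirection a ha0 d hd
  have hrhs : (2 * Real.pi * I * s : ℂ) ≠ 0 := by
    have hsC : (s : ℂ) ≠ 0 := by rcases hs with rfl | rfl <;> simp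
    have hπ : (Real.pi : ℂ) ≠ 0 := Complex.ofReal_ne_zero.mpr Real.pi_pos.ne'
    simp [hsC, hπ, Complex.I_ne_zero]
  have hω0 : ω ≠ 0 := by
    rintro rfl
    rw [zero_pow (by omega), mul_zero] at hω
    exact hrhs hω.symm
  have hωpos : 0 < ‖ω‖ := norm_pos_iff.mpr hω0
  -- the limit function `h(u) = Q_top(θ e^u)`
  set h : ℂ → ℂ := fun u => Qt.eval (θ * exp u) with hh_def
  have hh : Differentiable ℂ h :=
    (Polynomial.differentiable Qt).comp ((differentiable_const θ).mul differentiable_exp)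
  have hh0 : h 0 = 0 := by
    simp only [hh_def, Complex.exp_zero, mul_one]; exact hθ
  have hhne : ∃ u, h u ≠ 0 := by
    by_contra hall
    push Not at hall
    have hinf : Set.Infinite {x : ℂ | Qt.IsRoot x} := by
      have hinj : Function.Injective (fun t : ℝ => θ * exp (t : ℂ)) := by
        intro t₁ t₂ ht
        have h1 : exp (t₁ : ℂ) = exp (t₂ : ℂ) := mul_left_cancel₀ hθ0 ht
        have h2 : Real.exp t₁ = Real.exp t₂ := by
          have := congrArg norm h1
          rwa [Complex.norm_exp, Complex.norm_exp, Complex.ofReal_re, Complex.ofReal_re] at this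
        exact Real.exp_injective h2
      have hsub : Set.range (fun t : ℝ => θ * exp (t : ℂ)) ⊆ {x : ℂ | Qt.IsRoot x} := by
        rintro _ ⟨t, rfl⟩
        exact hall t
      exact (Set.infinite_range_of_injective hinj).mono hsub
    exact hQ (Polynomial.eq_zero_of_infinite_isRoot Qt hinf)
  -- stage sizes and eventual conditions
  set Λ : ℕ → ℝ := fun k => ((k : ℝ) + 1) * ‖ω‖ with hΛ_def
  have hΛ : Tendsto Λ atTop atTop := (tendsto_natCast_add_atTop 1).atTop_mul_const hωpos
  set C₁ : ℝ := coeffNormSum ℓ * (3 * ‖ω‖ + 1) ^ (d - 1) + ‖c₀‖ with hC₁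
  have hev₁ : ∀ᶠ k : ℕ in atTop, 32 * C₁ ≤ 2 * Real.pi * ((k : ℝ) + 1) :=
    ((tendsto_natCast_add_atTop 1).const_mul_atTop (by positivity : (0 : ℝ) < 2 * Real.pi)
      ).eventually_ge_atTop _
  have hev₂ : ∀ᶠ k : ℕ in atTop, 3 ≤ Λ k := hΛ.eventually_ge_atTop 3
  have hev₃ : ∀ᶠ k : ℕ in atTop, 6 ≤ ‖a‖ * Λ k := (hΛ.const_mul_atTop hapos).eventually_ge_atTop 6
  have hev₄ : ∀ᶠ k : ℕ in atTop, 16 ≤ Λ k := hΛ.eventually_ge_atTop 16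
  obtain ⟨K₀, hK₀⟩ := eventually_atTop.1 (hev₁.and (hev₂.and (hev₃.and hev₄)))
  -- the roots `z₀(j)` at stage `j + K₀`
  have hroot : ∀ j : ℕ, ∃ z₀ : ℂ, exp (R.eval z₀) = θ ∧ (R.eval z₀).re = Real.log ‖θ‖ ∧
      1 ≤ ‖z₀‖ ∧ 2 ≤ ‖a‖ * ‖z₀‖ ∧ z₀.re ≤ -(3 / 16) * Λ (j + K₀) ∧
      ‖z₀‖ ≤ 3 * Λ (j + K₀) ∧ z₀.re + 1 ≤ 0 := by
    intro j
    obtain ⟨h1, h2, h3, h4⟩ := hK₀ (j + K₀) (Nat.le_add_left _ _)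
    obtain ⟨z₀, hz₀, hup, hlow, hre₀⟩ := exists_alRoot R hd ω s hs hω hre c₀ (j + K₀)
      (by push_cast at h1 ⊢; linarith)
    have hΛk : Λ (j + K₀) = (((j + K₀ : ℕ) : ℝ) + 1) * ‖ω‖ := rfl
    refine ⟨z₀, ?_, ?_, ?_, ?_, ?_, ?_, ?_⟩
    · rw [hz₀, Complex.exp_add, Complex.exp_int_mul_two_pi_mul_I, one_mul, hc₀]
    · rw [hz₀, Complex.add_re, gce_re_intCast_mul_two_pi_I, zero_add, hc₀_def, Complex.log_re]
    · rw [hΛk] at h2; linarith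
    · rw [hΛk] at h3; nlinarith [mul_le_mul_of_nonneg_left hlow hapos.le]
    · rw [hΛk]; linarith
    · rw [hΛk]; linarith
    · rw [hΛk] at h4; linarith
  choose z₀ hz₀θ hz₀re hz₀1 hz₀2 hz₀neg hz₀up hz₀nonpos using hroot
  have hz₀ne : ∀ j, z₀ j ≠ 0 := fun j => norm_pos_iff.1 (by linarith [hz₀1 j])
  -- the remainder constant and the local coordinates
  set K : ℝ := 1 / ‖a‖ + coeffNormSum ℓ * ((d - 1 : ℕ) : ℝ) * 2 ^ (d - 1) / ‖a‖ with hK_def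
  have hK0 : 0 ≤ K := by have := coeffNormSum_nonneg ℓ; positivity
  set φ : ℕ → ℂ → ℂ := fun j u =>
    z₀ j * exp (u / ((R.natDegree : ℂ) * (R.leadingCoeff * z₀ j ^ R.natDegree))) with hφ_def
  have hRem : ∀ j (u : ℂ), ‖u‖ ≤ 1 → ‖R.eval (φ j u) - R.eval (z₀ j) - u‖ ≤ K / ‖z₀ j‖ :=
    fun j u hu => norm_gceRem_le hd (hz₀1 j) (hz₀2 j) hu
  have hdisp : ∀ j (u : ℂ), ‖u‖ ≤ 1 → ‖φ j u - z₀ j‖ ≤ 1 := fun j u hu => by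
    obtain ⟨h1, h2⟩ := norm_gcePhi_sub_le (R := R) (z₀ := z₀ j) hd (hz₀1 j) (hz₀2 j) hu
    exact h1.trans h2
  have hz₀norm : Tendsto (fun j => ‖z₀ j‖) atTop atTop := by
    refine tendsto_atTop_mono (fun j => ?_)
      ((hΛ.comp (tendsto_add_atTop_nat K₀)).const_mul_atTop (by norm_num : (0 : ℝ) < 3 / 16))
    have h1 := hz₀neg j
    have h2 := abs_re_le_norm (z₀ j)
    have h3 : -(z₀ j).re ≤ |(z₀ j).re| := neg_le_abs _
    simp only [Function.comp_apply]
    linarith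
  -- coefficient ratios: `‖q_j(φ u)/z₀ⁿ - [zⁿ]q_j‖ ≤ K_j/‖z₀‖`
  set Kq : ι → ℝ := fun j =>
    (coeffNormSum (q j) + coeffNormSum (q j).eraseLead + n * ‖(q j).coeff n‖) * 2 ^ n with hKq
  have hKq0 : ∀ j, 0 ≤ Kq j := fun j => by
    have := coeffNormSum_nonneg (q j); have := coeffNormSum_nonneg (q j).eraseLead
    simp only [hKq]; positivity
  have hratio : ∀ j ∈ J, ∀ i (u : ℂ), ‖u‖ ≤ 1 →
      ‖(q j).eval (φ i u) / z₀ i ^ n - (q j).coeff n‖ ≤ Kq j / ‖z₀ i‖ :=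
    fun j hj i u hu => norm_eval_div_pow_sub_coeff_le (q j) (hq j hj) (hz₀1 i) (hdisp i u hu)
  -- the rescaled functions `G_i(u) = g(φ_i(u)) / z₀(i)ⁿ`
  set g : ℂ → ℂ := fun z => (∑ j ∈ J, (q j).eval z * exp (R.eval z) ^ (e j)) + E z with hg_def
  set G : ℕ → ℂ → ℂ := fun i u => g (φ i u) / z₀ i ^ n with hG_def
  have hgdiff : Differentiable ℂ g := by
    refine (Differentiable.fun_sum fun j _ => ?_).add hE
    exact (Polynomial.differentiable _).mul ((Polynomial.differentiable R).cexp.pow _)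
  have hGdiff : ∀ i, Differentiable ℂ (G i) := by
    intro i
    have hφ : Differentiable ℂ (φ i) := differentiable_gcePhi R (z₀ i)
    exact (hgdiff.comp hφ).div_const _
  -- the key identity `e^{R(φ u)} = θ e^{u + Rem u}`
  have hkey : ∀ i (u : ℂ), exp (R.eval (φ i u)) =
      θ * exp (u + (R.eval (φ i u) - R.eval (z₀ i) - u)) := by
    intro i u
    rw [← hz₀θ i, ← Complex.exp_add]
    congr 1
    ring
  -- uniform approximation on `closedBall 0 1`
  obtain ⟨C, hC0, N, hC⟩ := hEb (|Real.log ‖θ‖| + 2)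
  set W : ℝ := ‖θ‖ * Real.exp 2 with hW
  have hunif : ∀ η : ℝ, 0 < η → ∀ᶠ i in atTop, ∀ u ∈ closedBall (0 : ℂ) 1, ‖G i u - h u‖ < η := by
    intro η hη
    have hη3 : 0 < η / 3 := by positivity
    obtain ⟨β, hβ, hβh⟩ := Metric.uniformContinuousOn_iff.1
      ((isCompact_closedBall (0 : ℂ) 2).uniformContinuousOn_of_continuous hh.continuous.continuousOn)
      (η / 3) hη3
    have hevR : ∀ᶠ i in atTop, K / ‖z₀ i‖ < min β 1 :=
      (tendsto_const_nhds.div_atTop hz₀norm).eventually (gt_mem_nhds (lt_min hβ zero_lt_one))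
    -- the coefficient-tail term `Σ_j K_j W^j / ‖z₀‖ < η/3`
    have hevT : ∀ᶠ i in atTop, (∑ j ∈ J, Kq j * W ^ (e j)) / ‖z₀ i‖ < η / 3 :=
      (tendsto_const_nhds.div_atTop hz₀norm).eventually (gt_mem_nhds hη3)
    -- the `E`-term `C (2 + 3Λ)^N e^{δ(1 - 3Λ/16)} < η/3`
    have hevE : ∀ᶠ i in atTop,
        C * ((2 + 3 * Λ (i + K₀)) ^ N * Real.exp (δ * (1 - (3 / 16) * Λ (i + K₀)))) < η / 3 := by
      have h1 := (tendsto_pow_mul_exp_escape (hΛ.comp (tendsto_add_atTop_nat K₀)) N hδ).const_mul C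
      rw [mul_zero] at h1
      exact h1.eventually (gt_mem_nhds hη3)
    filter_upwards [hevR, hevT, hevE] with i hiR hiT hiE u hu
    rw [mem_closedBall, dist_zero_right] at hu
    set ρ : ℂ := R.eval (φ i u) - R.eval (z₀ i) - u with hρ_def
    have hRem1 : ‖ρ‖ < min β 1 := (hRem i u hu).trans_lt hiR
    have hRemβ : ‖ρ‖ < β := hRem1.trans_le (min_le_left _ _)
    have hRem1' : ‖ρ‖ ≤ 1 := (hRem1.trans_le (min_le_right _ _)).le
    have hw : ‖θ * exp (u + ρ)‖ ≤ W := by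
      rw [norm_mul, Complex.norm_exp, hW]
      refine mul_le_mul_of_nonneg_left (Real.exp_le_exp.2 ?_) (norm_nonneg _)
      have := re_le_norm (u + ρ)
      have := norm_add_le u ρ
      linarith
    -- (1) the top term
    have hQterm : ‖Qt.eval (θ * exp (u + ρ)) - h u‖ < η / 3 := by
      have hmem1 : u + ρ ∈ closedBall (0 : ℂ) 2 := by
        rw [mem_closedBall, dist_zero_right]
        exact (norm_add_le _ _).trans (by linarith)
      have hmem2 : u ∈ closedBall (0 : ℂ) 2 := by
        rw [mem_closedBall, dist_zero_right]; linarith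
      have hdist : dist (u + ρ) u < β := by
        rw [dist_eq_norm, add_sub_cancel_left]; exact hRemβ
      have := hβh _ hmem1 _ hmem2 hdist
      rwa [dist_eq_norm] at this
    -- (2) the coefficient-tail term
    have hTterm :
        ‖∑ j ∈ J, ((q j).eval (φ i u) / z₀ i ^ n - (q j).coeff n) * (θ * exp (u + ρ)) ^ (e j)‖
        < η / 3 := by
      refine lt_of_le_of_lt ?_ hiT
      rw [Finset.sum_div]
      refine (norm_sum_le _ _).trans (Finset.sum_le_sum fun j hj => ?_)
      rw [norm_mul, norm_pow]
      calc ‖(q j).eval (φ i u) / z₀ i ^ n - (q j).coeff n‖ * ‖θ * exp (u + ρ)‖ ^ (e j)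
          ≤ Kq j / ‖z₀ i‖ * W ^ (e j) :=
            mul_le_mul (hratio j hj i u hu) (pow_le_pow_left₀ (norm_nonneg _) hw (e j))
              (by positivity) (div_nonneg (hKq0 j) (norm_nonneg _))
        _ = Kq j * W ^ (e j) / ‖z₀ i‖ := by ring
    -- (3) the `E`-term
    have hEterm : ‖E (φ i u) / z₀ i ^ n‖ < η / 3 := by
      have hre1 : (φ i u).re ≤ (z₀ i).re + 1 := by
        have h1 := re_le_norm (φ i u - z₀ i)
        rw [Complex.sub_re] at h1
        linarith [hdisp i u hu]
      have hre0 : (φ i u).re ≤ 0 := hre1.trans (hz₀nonpos i)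
      have hReR : |(R.eval (φ i u)).re| ≤ |Real.log ‖θ‖| + 2 := by
        have e1 : (R.eval (φ i u)).re = Real.log ‖θ‖ + (u.re + ρ.re) := by
          rw [← hz₀re i, ← Complex.add_re, ← Complex.add_re]
          congr 1
          rw [hρ_def]; ring
        rw [e1]
        have h1 := abs_re_le_norm u
        have h2 := abs_re_le_norm ρ
        have h3 := abs_add_le (Real.log ‖θ‖) (u.re + ρ.re)
        have h4 := abs_add_le u.re ρ.re
        linarith
      have h5 := hC _ hre0 hReR
      have hnorm : ‖φ i u‖ ≤ 1 + 3 * Λ (i + K₀) := by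
        have := norm_le_insert' (φ i u) (z₀ i)
        linarith [hdisp i u hu, hz₀up i]
      have hden : 1 ≤ ‖z₀ i ^ n‖ := by rw [norm_pow]; exact one_le_pow₀ (hz₀1 i)
      rw [norm_div]
      calc ‖E (φ i u)‖ / ‖z₀ i ^ n‖ ≤ ‖E (φ i u)‖ := div_le_self (norm_nonneg _) hden
        _ ≤ C * (1 + ‖φ i u‖) ^ N * Real.exp (δ * (φ i u).re) := h5
        _ ≤ C * ((2 + 3 * Λ (i + K₀)) ^ N * Real.exp (δ * (1 - (3 / 16) * Λ (i + K₀)))) := by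
            rw [mul_assoc]
            refine mul_le_mul_of_nonneg_left ?_ hC0
            refine mul_le_mul (pow_le_pow_left₀ (by positivity) (by linarith) N)
              (Real.exp_le_exp.2 (mul_le_mul_of_nonneg_left (by linarith [hz₀neg i]) hδ.le))
              (Real.exp_nonneg _) (by positivity)
        _ < η / 3 := hiE
    -- assemble: `G i u - h u = (top - h) + tail + E/z₀ⁿ`
    have hGsplit : G i u - h u = (Qt.eval (θ * exp (u + ρ)) - h u) +
        (∑ j ∈ J, ((q j).eval (φ i u) / z₀ i ^ n - (q j).coeff n) * (θ * exp (u + ρ)) ^ (e j)) +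
        E (φ i u) / z₀ i ^ n := by
      have hQte : Qt.eval (θ * exp (u + ρ)) =
          ∑ j ∈ J, (q j).coeff n * (θ * exp (u + ρ)) ^ (e j) := by
        rw [hQt, Polynomial.eval_finsetSum]
        refine Finset.sum_congr rfl fun j _ => ?_
        rw [Polynomial.eval_mul, Polynomial.eval_C, Polynomial.eval_pow, Polynomial.eval_X]
      rw [hG_def, hg_def]
      simp only []
      rw [add_div, Finset.sum_div, hkey i u, hQte]
      have : ∑ j ∈ J, (q j).eval (φ i u) * (θ * exp (u + ρ)) ^ (e j) / z₀ i ^ n =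
          ∑ j ∈ J, ((q j).eval (φ i u) / z₀ i ^ n - (q j).coeff n) * (θ * exp (u + ρ)) ^ (e j) +
            ∑ j ∈ J, (q j).coeff n * (θ * exp (u + ρ)) ^ (e j) := by
        rw [← Finset.sum_add_distrib]
        refine Finset.sum_congr rfl fun j _ => ?_
        ring
      rw [this]
      ring
    rw [hGsplit]
    calc ‖(Qt.eval (θ * exp (u + ρ)) - h u) +
          (∑ j ∈ J, ((q j).eval (φ i u) / z₀ i ^ n - (q j).coeff n) * (θ * exp (u + ρ)) ^ (e j)) +
          E (φ i u) / z₀ i ^ n‖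
        ≤ ‖Qt.eval (θ * exp (u + ρ)) - h u‖ +
          ‖∑ j ∈ J, ((q j).eval (φ i u) / z₀ i ^ n - (q j).coeff n) * (θ * exp (u + ρ)) ^ (e j)‖ +
          ‖E (φ i u) / z₀ i ^ n‖ := norm_add₃_le
      _ < η / 3 + η / 3 + η / 3 := by gcongr
      _ = η := by ring
  -- persistence
  have hzeros := eventually_exists_zero_of_unif_approx hh hhne hh0 hGdiff zero_lt_one hunif
  obtain ⟨K₁, hK₁⟩ := eventually_atTop.1 hzeros
  have hsol : ∀ k : ℕ, ∃ u : ℂ, ‖u‖ ≤ 1 ∧ G (k + K₁) u = 0 := by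
    intro k
    obtain ⟨u, hu, hu0⟩ := hK₁ (k + K₁) (Nat.le_add_left _ _)
    rw [mem_ball, dist_zero_right] at hu
    exact ⟨u, hu.le, hu0⟩
  choose u hu1 hu0 using hsol
  refine ⟨fun k => φ (k + K₁) (u k), fun k => (3 / 16) * Λ (k + K₁ + K₀) - 1,
    ?_, fun k => ⟨?_, ?_, ?_⟩⟩
  · refine tendsto_atTop_add_const_right _ (-1) ?_
    have : Tendsto (fun k => Λ (k + K₁ + K₀)) atTop atTop := by
      have h1 := hΛ.comp (tendsto_add_atTop_nat (K₁ + K₀))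
      refine h1.congr fun k => ?_
      simp only [Function.comp_apply, add_assoc]
    exact this.const_mul_atTop (by norm_num : (0 : ℝ) < 3 / 16)
  · have h0 := hu0 k
    have hzn : z₀ (k + K₁) ^ n ≠ 0 := pow_ne_zero _ (hz₀ne _)
    have : g (φ (k + K₁) (u k)) = 0 := by
      rw [hG_def] at h0
      exact (div_eq_zero_iff.1 h0).resolve_right hzn
    simpa [hg_def] using this
  · have h1 := re_le_norm (φ (k + K₁) (u k) - z₀ (k + K₁))
    rw [Complex.sub_re] at h1
    have h2 := hdisp (k + K₁) (u k) (hu1 k)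
    have h3 := hz₀neg (k + K₁)
    linarith
  · have h1 := norm_le_insert' (φ (k + K₁) (u k)) (z₀ (k + K₁))
    have h2 := hdisp (k + K₁) (u k) (hu1 k)
    have h3 := hz₀up (k + K₁)
    linarith

end Summit.Schanuel.Schanuel.Theorems
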